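import Summits.BirchSwinnertonDyer.Rank1Residual.X11b.Three.MultiplicativeNodePresentation
import Literature.NumberTheory.EllipticCurves.UnramifiedCoboundaryInputs
import Literature.NumberTheory.DiophantineGeometry.TateAlgorithmProofs
import HarnessLib

/-!
# X11b at `p = 3` (team N8/O2), S15 (iii)(b/c): inputs for the inertia-invariant Frobenius lift at
# a place of MULTIPLICATIVE reduction — torus "Lang", the presented node over `k_{𝒪_w}`, Hensel lifts

HONEST FRAMING (cell `b2b-bsdres`, run/shared/lean/b2b/bsd-rank1-residual/, verbatim in every
file): the goal of the cell is to DELETE the COMBINATION-SHAPED residual classes of the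
Birch–Swinnerton-Dyer formula for ALL analytic-rank `≤ 1` elliptic curves over `ℚ` — "full BSD
formula for every rank `≤ 1` curve in class `C`" assembled STRICTLY from published theorems — so
that the rank-`≤ 1` remainder becomes exactly the CONSTRUCTION-SHAPED classes, which are TYPED
(missing-input `Prop`s), NOT attempted. This is not "finishing BSD". Team N8/O2 = `x11b3`, seat
`b2b-bsdres-x11b3-p8` (GEN 3), LEAD DEAL #7 (R7-7) S15 (iii)(b/c). LABEL OF RECORD: flag-discharge
hygiene for `JET@p|N` (harvest E66 (D)) — NOT count-moving; nothing is booked; `O2` OPEN.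
THEOREMS ONLY: no definition, no named fact, no `sorry`.

## What

Inputs of the multiplicative twin (`UnramifiedClassNodeLift`) of the tree's
`GoodReductionLangLift.exists_lift_sub_mem_kernel` (Milne *ADT* I.3.8, Step 1), in the
`K̄_v`-currency of `SelmerInertia` (`K_v = v.adicCompletion K`, `K̄_v`, the spectral valuation `w`
with valuation ring `𝒪_w` and algebraically closed residue field `k_{𝒪_w}`, the prime `𝔐` of
`\bar 𝓞_v` with inertia group `I_𝔐 ≤ Γ_{K_v}`, the structure map `ι : 𝓞_v → 𝒪_w`):

* §1 "Lang's theorem" for the one-dimensional tori over an algebraically closed field: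
  `β^q = a·β` (`exists_pow_eq_mul_self`, split torus `𝔾_m`, `F(β)/β = a`) and `a·β·β^q = 1`
  (`exists_mul_mul_pow_eq_one`, norm-one torus, `F(β)⁻¹/β = a`) are solvable with `β ≠ 0`
  (Silverman *AEC* Ex. 3.5(a)).
* §2 `baseChange_map_eq_baseChange_map` (`(M ⊗ K_v) ⊗ K̄_v = (M.map ι) ⊗ K̄_v`, the tree's `hX`) and
  `exists_map_residue_eq_singularModel_of_hasMultiplicativeReductionAt`: at a place of
  multiplicative reduction the `𝒪_w`-model `M.map ι` of the minimal model
  `M = W.localMinimalIntegralModel v` reduces to a PRESENTED node `singularModel x₀ y₀ α₁ α₂`,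
  `α₁ ≠ α₂` (Silverman *AEC* VII.5.1(b): `π ∣ Δ`, `π ∤ c₄`, tree `hasMultiplicativeReductionAt_iff_mem`;
  the node presentation is the cell's `exists_map_residue_eq_singularModel_of_splits`, p8 S15
  (iii)(a), the tangent quadratic splitting over the algebraically closed `k_{𝒪_w}`).
* §3 `exists_lift_forall_inertia`: every nonsingular affine point of the reduction of `M.map ι`
  (any `𝓞_v`-equation `M`) lifts to an `𝒪_w`-point of `M.map ι` with `I_𝔐`-INVARIANT coordinates:
  one coordinate lifted to `0` or a Teichmüller representative (`exists_residue_eq_forall_inertia`),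
  the other solved by Hensel's lemma in `𝒪_w` at a non-vanishing partial derivative, unique in its
  residue class hence `I_𝔐`-fixed (`exists_isRoot_residue_eq_forall`) — the block (R5) of the tree's
  good-reduction proof, verbatim, stated on its own.

References (locators only; no cited FACT): [cite: MilneADT2006, Ch. I Prop. 3.8 (proof)]
[cite: SilvermanAEC2009, Prop. III.2.5(a), Prop. VII.5.1(b), Exercise 3.5(a)]
[cite: NeukirchANT1999, Ch. II §6 (4.6) (Hensel's lemma)]; tree files `GoodReductionLangLift`,
`UnramifiedCoboundaryInputs`, `TateAlgorithmProofs`; cell file `MultiplicativeNodePresentation`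
(p255042).

## Design

`noncomputable section`; no definitions; no local notation; heartbeats raised for §3 (long
transport proof, as in the tree). Namespace
`Summit.BirchSwinnertonDyer.Rank1Residual.X11b.Three.UnramifiedNode`. Axioms: `propext`,
`Classical.choice`, `Quot.sound`.
-/

noncomputable section

open scoped Classical NNReal
open NumberField IsDedekindDomain Field Polynomial ValuativeRel

universe u

namespace Summit.BirchSwinnertonDyer.Rank1Residual.X11b.Three.UnramifiedNode

open WeierstrassCurve Literature.NumberTheory.EllipticCurves
  Literature.NumberTheory.EllipticCurves.FormalGroupChart
  Literature.NumberTheory.GaloisRepresentations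
  Literature.NumberTheory.GaloisRepresentations.IsNonarchimedeanLocalField IsDedekindDomain.HeightOneSpectrum
  Summit.BirchSwinnertonDyer.Rank1Residual.X11b.Three.JetchevKummer

/-! ### §1 Torus "Lang": `β ↦ F(β)^{±1}/β` is onto `k̄ˣ` -/

section Torus

variable {k : Type*} [Field k] [IsAlgClosed k]

/-- **"Lang's theorem" for the split torus `𝔾_m` over an algebraically closed field**: for
`q ≥ 2` and `a ≠ 0` there is `β ≠ 0` with `β^q = a·β`, i.e. `F(β)/β = a` for `F = (·)^q`
(take a `(q-1)`-th root of `a`). Silverman, *AEC*, Ex. 3.5(a) (`Ẽ_ns(k) ≅ k^*` at a split node).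
[folklore] -/
theorem exists_pow_eq_mul_self {q : ℕ} (hq : 2 ≤ q) {a : k} (ha : a ≠ 0) :
    ∃ β : k, β ≠ 0 ∧ β ^ q = a * β := by
  obtain ⟨β, hβ⟩ := IsAlgClosed.exists_pow_nat_eq a (by omega : 0 < q - 1)
  have hβ0 : β ≠ 0 := by
    rintro rfl
    rw [zero_pow (by omega : q - 1 ≠ 0)] at hβ
    exact ha hβ.symm
  refine ⟨β, hβ0, ?_⟩
  rw [← hβ, ← pow_succ, Nat.sub_add_cancel (by omega : 1 ≤ q)]

/-- **"Lang's theorem" for the non-split torus**: for `a ≠ 0` there is `β ≠ 0` with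
`a · β · β^q = 1`, i.e. `F(β)⁻¹/β = a` for `F = (·)^q` (take a `(q+1)`-th root of `a⁻¹`).
Silverman, *AEC*, Ex. 3.5(a) (`Ẽ_ns(k)` = norm-one torus at a non-split node). [folklore] -/
theorem exists_mul_mul_pow_eq_one (q : ℕ) {a : k} (ha : a ≠ 0) :
    ∃ β : k, β ≠ 0 ∧ a * β * β ^ q = 1 := by
  obtain ⟨β, hβ⟩ := IsAlgClosed.exists_pow_nat_eq a⁻¹ (by omega : 0 < q + 1)
  have hβ0 : β ≠ 0 := by
    rintro rfl
    rw [zero_pow (by omega : q + 1 ≠ 0)] at hβ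
    exact inv_ne_zero ha hβ.symm
  refine ⟨β, hβ0, ?_⟩
  rw [mul_assoc, ← pow_succ', hβ, mul_inv_cancel₀ ha]

end Torus

/-! ### §2 The model over `𝒪_w`: transport and the node presentation of its reduction -/

section Model

variable {K : Type u} [Field K] [NumberField K] {v : HeightOneSpectrum (𝓞 K)}
  {w : Valuation (AlgebraicClosure (v.adicCompletion K)) ℝ≥0}
  (hw : ∀ x, (w x : ℝ) = spectralNorm (v.adicCompletion K) (AlgebraicClosure (v.adicCompletion K)) x)
  {ι : v.adicCompletionIntegers K →+* w.integer}
  (hι : ∀ a, ((ι a : w.integer) : AlgebraicClosure (v.adicCompletion K)) =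
    algebraMap (v.adicCompletion K) (AlgebraicClosure (v.adicCompletion K)) (a : v.adicCompletion K))

include hι in
/-- **The model over `𝒪_w`.** Along the structure map `ι : 𝓞_v → 𝒪_w` (`exists_ringHom_adicCompletionIntegers_integer`),
an `𝓞_v`-equation `M` read in `K̄_v` through `K_v` is the `𝒪_w`-equation `M.map ι` read in `K̄_v`:
`(M ⊗ K_v) ⊗ K̄_v = (M.map ι) ⊗ K̄_v` (the tree's `hX` in `GoodReductionLangLift`). [folklore] -/
theorem baseChange_map_eq_baseChange_map (M : WeierstrassCurve (v.adicCompletionIntegers K)) :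
    (M.map (algebraMap (v.adicCompletionIntegers K) (v.adicCompletion K))).baseChange
        (AlgebraicClosure (v.adicCompletion K)) =
      (M.map ι).baseChange (AlgebraicClosure (v.adicCompletion K)) := by
  have hcompL : (algebraMap w.integer (AlgebraicClosure (v.adicCompletion K))).comp ι =
      (algebraMap (v.adicCompletion K) (AlgebraicClosure (v.adicCompletion K))).comp
        (algebraMap (v.adicCompletionIntegers K) (v.adicCompletion K)) := by
    ext a
    exact hι a
  simp only [baseChange, WeierstrassCurve.map_map, hcompL]

include hw hι in
/-- **The reduction of the minimal model at a place of multiplicative reduction is a PRESENTED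
node over `k_{𝒪_w} ≅ k̄_v`.** For `M = W.localMinimalIntegralModel v` with `W` of multiplicative
reduction at `v` (`π ∣ Δ(M)`, `π ∤ c₄(M)`: `hasMultiplicativeReductionAt_iff_mem`), the
`𝒪_w`-model `M.map ι` reduces to `singularModel x₀ y₀ α₁ α₂` with `α₁ ≠ α₂` in the residue field of
`𝒪_w`, which is algebraically closed (`isAlgClosed_residueField_integer`), so that Mathlib's tangent
quadratic splits and the cell's `exists_map_residue_eq_singularModel_of_splits` (p8, S15 (iii)(a))
applies. Silverman, *AEC*, VII.5.1(b), III.2.5. [cite: SilvermanAEC2009, Prop. VII.5.1(b)] -/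
theorem exists_map_residue_eq_singularModel_of_hasMultiplicativeReductionAt
    {W : WeierstrassCurve K} (hmult : W.HasMultiplicativeReductionAt v) :
    ∃ x₀ y₀ α₁ α₂ : IsLocalRing.ResidueField w.integer, α₁ ≠ α₂ ∧
      ((W.localMinimalIntegralModel v).map ι).map (IsLocalRing.residue w.integer) =
        singularModel x₀ y₀ α₁ α₂ := by
  haveI hιloc := isLocalHom_of_coe_eq hw hι
  haveI : IsAlgClosed (IsLocalRing.ResidueField w.integer) := isAlgClosed_residueField_integer w
  haveI : PerfectField (IsLocalRing.ResidueField w.integer) := IsAlgClosed.perfectField _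
  obtain ⟨hΔ, hc₄⟩ := (hasMultiplicativeReductionAt_iff_mem v W).mp hmult
  refine exists_map_residue_eq_singularModel_of_splits _ ?_ ?_ (IsAlgClosed.splits _)
  · rw [map_Δ, IsLocalRing.residue_eq_zero_iff, IsLocalRing.mem_maximalIdeal, mem_nonunits_iff]
    exact fun h ↦ (IsLocalRing.mem_maximalIdeal _ |>.mp hΔ) (isUnit_of_map_unit ι _ h)
  · rw [map_c₄, Ne, IsLocalRing.residue_eq_zero_iff, IsLocalRing.mem_maximalIdeal, mem_nonunits_iff,
      not_not]
    have hu : IsUnit (W.localMinimalIntegralModel v).c₄ := by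
      by_contra h
      exact hc₄ ((IsLocalRing.mem_maximalIdeal _).mpr h)
    exact hu.map ι

end Model

/-! ### §3 Inertia-invariant lifts of nonsingular points of the reduction -/

section Lift

variable {K : Type u} [Field K] [NumberField K] {v : HeightOneSpectrum (𝓞 K)}
  {w : Valuation (AlgebraicClosure (v.adicCompletion K)) ℝ≥0}
  (hw : ∀ x, (w x : ℝ) = spectralNorm (v.adicCompletion K) (AlgebraicClosure (v.adicCompletion K)) x)
  {ι : v.adicCompletionIntegers K →+* w.integer}
  (hι : ∀ a, ((ι a : w.integer) : AlgebraicClosure (v.adicCompletion K)) =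
    algebraMap (v.adicCompletion K) (AlgebraicClosure (v.adicCompletion K)) (a : v.adicCompletion K))

include hw hι in
set_option maxHeartbeats 800000 in
/-- **Inertia-invariant integral lifts of nonsingular points of the reduction** (the Hensel half
of Milne's proof of *ADT* I.3.8, valid for ANY `𝓞_v`-equation `M`): every nonsingular affine point
`(α₀, β₀)` of the reduction of `W₀ = M.map ι` modulo `𝔪_w` lifts to an `𝒪_w`-point `(a, b)` of `W₀`
whose coordinates are fixed by the inertia group `I_𝔐` (i.e. lie in `K_v^{nr}`): lift one
coordinate to `0` or a Teichmüller representative (`exists_residue_eq_forall_inertia`) and solve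
for the other by Hensel's lemma in `𝒪_w` at a non-vanishing partial derivative, the lift being
unique in its residue class and hence `I_𝔐`-invariant (`exists_isRoot_residue_eq_forall`). This is
the block (R5) of the tree's `GoodReductionLangLift.exists_lift_sub_mem_kernel`, verbatim, stated
on its own. [cite: MilneADT2006, Ch. I Prop. 3.8 (proof)]
[cite: NeukirchANT1999, Ch. II §6 (4.6) (Hensel's lemma)] -/
theorem exists_lift_forall_inertia {𝔐 : Ideal v.localAbsIntegers} (h𝔐 : 𝔐 ∈ v.localPrimesAbove)
    (M : WeierstrassCurve (v.adicCompletionIntegers K))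
    {α₀ β₀ : IsLocalRing.ResidueField w.integer}
    (hns : ((M.map ι).map (IsLocalRing.residue w.integer)).toAffine.Nonsingular α₀ β₀) :
    ∃ a b : w.integer, (M.map ι).toAffine.Equation a b ∧
      IsLocalRing.residue w.integer a = α₀ ∧ IsLocalRing.residue w.integer b = β₀ ∧
      (∀ τ ∈ 𝔐.inertia (absoluteGaloisGroup (v.adicCompletion K)),
        absoluteGaloisGroup.toAlgEquiv (v.adicCompletion K) τ
          (a : AlgebraicClosure (v.adicCompletion K)) = a) ∧
      (∀ τ ∈ 𝔐.inertia (absoluteGaloisGroup (v.adicCompletion K)),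
        absoluteGaloisGroup.toAlgEquiv (v.adicCompletion K) τ
          (b : AlgebraicClosure (v.adicCompletion K)) = b) := by
  set W₀ : WeierstrassCurve w.integer := M.map ι with hW₀
  -- the subring of `𝒪_w` fixed by `I_𝔐`
  let S : Subring w.integer :=
    { carrier := {z | ∀ τ ∈ 𝔐.inertia (absoluteGaloisGroup (v.adicCompletion K)),
        absoluteGaloisGroup.toAlgEquiv (v.adicCompletion K) τ (z : AlgebraicClosure (v.adicCompletion K)) = z}
      one_mem' := fun τ _ ↦ by simp
      zero_mem' := fun τ _ ↦ by simp
      add_mem' := fun {a b} ha hb τ hτ ↦ by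
        simp only [Set.mem_setOf_eq] at ha hb
        rw [Subring.coe_add, map_add, ha τ hτ, hb τ hτ]
      mul_mem' := fun {a b} ha hb τ hτ ↦ by
        simp only [Set.mem_setOf_eq] at ha hb
        rw [Subring.coe_mul, map_mul, ha τ hτ, hb τ hτ]
      neg_mem' := fun {a} ha τ hτ ↦ by
        simp only [Set.mem_setOf_eq] at ha
        rw [Subring.coe_neg, map_neg, ha τ hτ] }
  have hSmem : ∀ z : w.integer, z ∈ S ↔ ∀ τ ∈ 𝔐.inertia (absoluteGaloisGroup (v.adicCompletion K)),
      absoluteGaloisGroup.toAlgEquiv (v.adicCompletion K) τ (z : AlgebraicClosure (v.adicCompletion K)) = z :=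
    fun _ ↦ Iff.rfl
  have hιS : ∀ c : v.adicCompletionIntegers K, ι c ∈ S := fun c τ _ ↦ by
    rw [hι]; exact AlgEquiv.commutes _ _
  have ha₁S : W₀.a₁ ∈ S := by rw [hW₀, map_a₁]; exact hιS _
  have ha₂S : W₀.a₂ ∈ S := by rw [hW₀, map_a₂]; exact hιS _
  have ha₃S : W₀.a₃ ∈ S := by rw [hW₀, map_a₃]; exact hιS _
  have ha₄S : W₀.a₄ ∈ S := by rw [hW₀, map_a₄]; exact hιS _
  have ha₆S : W₀.a₆ ∈ S := by rw [hW₀, map_a₆]; exact hιS _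
  obtain ⟨heq, hpart⟩ := (Affine.nonsingular_iff' _ _).mp hns
  rw [Affine.equation_iff] at heq
  have ea₁ : (W₀.map (IsLocalRing.residue w.integer)).toAffine.a₁ = IsLocalRing.residue w.integer W₀.a₁ := rfl
  have ea₂ : (W₀.map (IsLocalRing.residue w.integer)).toAffine.a₂ = IsLocalRing.residue w.integer W₀.a₂ := rfl
  have ea₃ : (W₀.map (IsLocalRing.residue w.integer)).toAffine.a₃ = IsLocalRing.residue w.integer W₀.a₃ := rfl
  have ea₄ : (W₀.map (IsLocalRing.residue w.integer)).toAffine.a₄ = IsLocalRing.residue w.integer W₀.a₄ := rfl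
  have ea₆ : (W₀.map (IsLocalRing.residue w.integer)).toAffine.a₆ = IsLocalRing.residue w.integer W₀.a₆ := rfl
  rw [ea₁, ea₂, ea₃, ea₄, ea₆] at heq
  rw [ea₁, ea₂, ea₃, ea₄] at hpart
  by_cases hY : 2 * β₀ + IsLocalRing.residue w.integer W₀.a₁ * α₀ + IsLocalRing.residue w.integer W₀.a₃ ≠ 0
  · -- lift `α₀` invariantly, solve the monic quadratic in `Y` by Hensel
    obtain ⟨a, ha, haI⟩ := exists_residue_eq_forall_inertia hw h𝔐 α₀
    have haS : a ∈ S := (hSmem a).mpr haI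
    set c₁ : w.integer := W₀.a₁ * a + W₀.a₃ with hc₁
    set c₀ : w.integer := a ^ 3 + W₀.a₂ * a ^ 2 + W₀.a₄ * a + W₀.a₆ with hc₀
    have hc₁S : c₁ ∈ S := S.add_mem (S.mul_mem ha₁S haS) ha₃S
    have hc₀S : c₀ ∈ S := S.add_mem (S.add_mem (S.add_mem (S.pow_mem haS 3)
      (S.mul_mem ha₂S (S.pow_mem haS 2))) (S.mul_mem ha₄S haS)) ha₆S
    set f : (w.integer)[X] := X ^ 2 + C c₁ * X - C c₀ with hf
    have hfmonic : f.Monic := by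
      rw [hf, sub_eq_add_neg, add_assoc]
      refine (monic_X_pow 2).add_of_left ?_
      refine (degree_add_le _ _).trans_lt (max_lt ?_ ?_)
      · exact (degree_C_mul_X_le _).trans_lt (by rw [degree_X_pow]; norm_num)
      · rw [degree_neg]; exact (degree_C_le).trans_lt (by rw [degree_X_pow]; norm_num)
    have hfcoeff : ∀ i, f.coeff i ∈ S := by
      intro i
      rw [hf]
      simp only [coeff_add, coeff_sub, coeff_X_pow, coeff_C_mul, coeff_X, coeff_C]
      refine S.sub_mem (S.add_mem ?_ (S.mul_mem hc₁S ?_)) ?_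
      · split_ifs
        · exact S.one_mem
        · exact S.zero_mem
      · split_ifs
        · exact S.one_mem
        · exact S.zero_mem
      · split_ifs
        · exact hc₀S
        · exact S.zero_mem
    have hroot : (f.map (IsLocalRing.residue w.integer)).IsRoot β₀ := by
      rw [IsRoot.def, eval_map, hf]
      simp only [eval₂_add, eval₂_sub, eval₂_mul, eval₂_pow, eval₂_C, eval₂_X, hc₁, hc₀, map_add,
        map_mul, map_pow, ha]
      linear_combination heq
    have hder : (f.map (IsLocalRing.residue w.integer)).derivative.eval β₀ ≠ 0 := by
      have : (f.map (IsLocalRing.residue w.integer)).derivative.eval β₀ =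
          2 * β₀ + IsLocalRing.residue w.integer W₀.a₁ * α₀ + IsLocalRing.residue w.integer W₀.a₃ := by
        rw [derivative_map, eval_map, hf]
        simp only [derivative_sub, derivative_X_pow, derivative_mul, derivative_C,
          derivative_X, zero_mul, zero_add, mul_one, sub_zero, eval₂_add, eval₂_mul, eval₂_ofNat,
          mul_zero, add_zero, eval₂_C, eval₂_X, hc₁, map_add, map_mul, ha, map_ofNat, Nat.cast_ofNat,
          pow_one, Nat.add_one_sub_one]
        ring
      rw [this]; exact hY
    obtain ⟨b, hb, hbβ, hbI⟩ := exists_isRoot_residue_eq_forall (v := v) f hfmonic β₀ hroot hder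
    have hbS : b ∈ S := fun τ hτ ↦ hbI _ (fun z ↦ spectralValuation_smul hw τ z)
      ((mem_inertia_iff_spectralValuation hw h𝔐).mp hτ) (fun i ↦ hfcoeff i τ hτ)
    have hWab : W₀.toAffine.Equation a b := by
      rw [Affine.equation_iff]
      rw [IsRoot.def, hf] at hb
      simp only [eval_add, eval_sub, eval_mul, eval_pow, eval_X, eval_C, hc₁, hc₀] at hb
      linear_combination hb
    exact ⟨a, b, hWab, ha, hbβ, haS, hbS⟩
  · -- lift `β₀` invariantly, solve the monic cubic in `X` by Hensel
    have hXp : IsLocalRing.residue w.integer W₀.a₁ * β₀ -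
        (3 * α₀ ^ 2 + 2 * IsLocalRing.residue w.integer W₀.a₂ * α₀ + IsLocalRing.residue w.integer W₀.a₄) ≠ 0 := by
      rw [not_not] at hY
      exact hpart.resolve_right (by rw [hY]; exact not_not.mpr rfl)
    obtain ⟨b, hb, hbI⟩ := exists_residue_eq_forall_inertia hw h𝔐 β₀
    have hbS : b ∈ S := (hSmem b).mpr hbI
    set c₂ : w.integer := W₀.a₂ with hc₂
    set c₁ : w.integer := W₀.a₄ - W₀.a₁ * b with hc₁
    set c₀ : w.integer := W₀.a₆ - b ^ 2 - W₀.a₃ * b with hc₀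
    have hc₂S : c₂ ∈ S := ha₂S
    have hc₁S : c₁ ∈ S := S.sub_mem ha₄S (S.mul_mem ha₁S hbS)
    have hc₀S : c₀ ∈ S := S.sub_mem (S.sub_mem ha₆S (S.pow_mem hbS 2)) (S.mul_mem ha₃S hbS)
    set g : (w.integer)[X] := X ^ 3 + C c₂ * X ^ 2 + C c₁ * X + C c₀ with hg
    have hgmonic : g.Monic := by
      rw [hg, add_assoc, add_assoc]
      refine (monic_X_pow 3).add_of_left ?_
      refine (degree_add_le _ _).trans_lt (max_lt ?_ ((degree_add_le _ _).trans_lt (max_lt ?_ ?_)))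
      · exact (degree_C_mul_X_pow_le 2 _).trans_lt (by rw [degree_X_pow]; norm_num)
      · exact (degree_C_mul_X_le _).trans_lt (by rw [degree_X_pow]; norm_num)
      · exact (degree_C_le).trans_lt (by rw [degree_X_pow]; norm_num)
    have hgcoeff : ∀ i, g.coeff i ∈ S := by
      intro i
      rw [hg]
      simp only [coeff_add, coeff_X_pow, coeff_C_mul, coeff_X, coeff_C]
      refine S.add_mem (S.add_mem (S.add_mem ?_ (S.mul_mem hc₂S ?_)) (S.mul_mem hc₁S ?_)) ?_
      · split_ifs
        · exact S.one_mem
        · exact S.zero_mem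
      · split_ifs
        · exact S.one_mem
        · exact S.zero_mem
      · split_ifs
        · exact S.one_mem
        · exact S.zero_mem
      · split_ifs
        · exact hc₀S
        · exact S.zero_mem
    have hroot : (g.map (IsLocalRing.residue w.integer)).IsRoot α₀ := by
      rw [IsRoot.def, eval_map, hg]
      simp only [eval₂_add, eval₂_sub, eval₂_mul, eval₂_pow, eval₂_C, eval₂_X, hc₂, hc₁, hc₀,
        map_sub, map_mul, map_pow, hb]
      linear_combination -heq
    have hder : (g.map (IsLocalRing.residue w.integer)).derivative.eval α₀ ≠ 0 := by
      have : (g.map (IsLocalRing.residue w.integer)).derivative.eval α₀ =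
          -(IsLocalRing.residue w.integer W₀.a₁ * β₀ -
            (3 * α₀ ^ 2 + 2 * IsLocalRing.residue w.integer W₀.a₂ * α₀ + IsLocalRing.residue w.integer W₀.a₄)) := by
        rw [derivative_map, eval_map, hg]
        simp only [derivative_add, derivative_X_pow, derivative_mul, derivative_C,
          derivative_X, zero_mul, zero_add, mul_one, add_zero, eval₂_add, eval₂_sub, eval₂_mul, eval₂_ofNat,
          mul_zero, sub_zero, eval₂_C, eval₂_X, eval₂_pow, hc₂, hc₁, map_sub, map_mul, hb, map_ofNat,
          Nat.cast_ofNat, pow_one, Nat.add_one_sub_one]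
        ring
      rw [this, neg_ne_zero]; exact hXp
    obtain ⟨a, ha, haα, haI⟩ := exists_isRoot_residue_eq_forall (v := v) g hgmonic α₀ hroot hder
    have haS : a ∈ S := fun τ hτ ↦ haI _ (fun z ↦ spectralValuation_smul hw τ z)
      ((mem_inertia_iff_spectralValuation hw h𝔐).mp hτ) (fun i ↦ hgcoeff i τ hτ)
    have hWab : W₀.toAffine.Equation a b := by
      rw [Affine.equation_iff]
      rw [IsRoot.def, hg] at ha
      simp only [eval_add, eval_mul, eval_pow, eval_X, eval_C, hc₂, hc₁, hc₀] at ha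
      linear_combination -ha
    exact ⟨a, b, hWab, haα, hb, haS, hbS⟩

end Lift

end Summit.BirchSwinnertonDyer.Rank1Residual.X11b.Three.UnramifiedNode

end
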